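import Literature.Geometry.Kaehler.ComplexTorusKunnethDiagonalDivisorFormula
import HarnessLib

/-!
# Scholl's explicit projectors `p_i` ACT as the Künneth projectors and are exchanged by transposition
# (Milne 1999, Thm. 5.10 — "cl(p_i) is the ith Künneth component of the diagonal" — operator form, torus level)

Layer `Literature/Geometry/Kaehler`, namespace `Literature.Geometry.Kaehler.ComplexTorus`; lane `lit-hodgefound`
(Track 2 foundations library), Layer A4, prover seat `lit-hodgefound-p08` (generation 11; FILE 2 of row g11-#1 = Q1166
«Milne 1999 Thm. 5.10 (proof display) + Rem. 5.11 = Scholl 1994 §5 (5.9) read in cohomology at torus level»).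
Sequel, BY NAME, of `ComplexTorusKunnethDiagonalDivisorFormula` (Q1166: `p_i = of (2g) π_i` in the graded ring,
`IsRiemannForm.schollProjector_eq_of_kunnethComponent_cycleForm_diagonal`, its read-out on `2g`-forms
`…schollProjector_apply_eq_kunnethComponent_cycleForm_diagonal`, and `σ^*π_i = π_{2g-i}`
`kunnethComponent_cycleForm_diagonal_compContinuousLinearMap_prodComm`), of `ComplexTorusKunnethDiagonalProjectors`
(Q383: `π_s` acts through Lange's (6.6) `corrAct` as the identity on `Hˢ(X)` and as `0` on `Hᵃ(X)`, `a ≠ s`,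
`corrAct_kunnethComponent_cycleForm_diagonal_cast`) and of `ComplexTorusSubtorusCycleClassFrameChange`
(`exists_orientationSign_eq_one`).

## Source, verbatim

J. S. Milne, *Lefschetz classes on abelian varieties*, Duke Math. J. **96** (1999) 639–675, held
`paper:doi-10-1215-s0012-7094-99-09620-5`, p. 665 (p0027 L16–L52): proof of Thm. 5.10, "define
`p_i = ((−1)ⁱ/deg(λ_D)) Σ_{max(0,i−g) ≤ j ≤ i/2} (1/(j!(g−i+j)!(i−2j)!)) p^*([D^{g−i+j}]) · q^*([Dʲ]) · [M]^{i−2j}`. …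
Then `p₀ + p₁ + ⋯ + p_{2g} = Δ_A` (identity in `C^g_rat(A × A)`) (Scholl 1994, Section 5)", and "Let `p_i` be the
class in `C^g_rat(A × A)` defined in the above proof. Then, for every Weil cohomology theory, `cl(p_i)` is the `i`th
Künneth component of the diagonal." (Scholl 1994, (5.9)–(5.10), after Künnemann 1993: the `p_i` are mutually
orthogonal projectors lifting the Künneth projectors, with `ᵗp_i = p_{2g−i}`.)

## What is proved (torus level; theorems only, no definitions, no named facts)

For a polarised complex torus `X = E/Φ(ℤ^ι)` of dimension `g` and type `(d₁, …, d_g)` (`hη : IsRiemannForm Φ η`,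
`hd : IsPolarizationType Φ η d`, `ω = c₁(L) = ofRealForm (-η)`, `μ = m^*ω − p₁^*ω − p₂^*ω`), Scholl's
`p_i = ((-1)ⁱ/(d₁⋯d_g)) Σ_j (1/(j!(g-i+j)!(i-2j)!)) (of 2 p₁^*ω)^{g-i+j} (of 2 p₂^*ω)^j (of 2 μ)^{i-2j}` (the torus-level
normalisation `√deg(λ_L) = d₁⋯d_g` of Q1166), read as an invariant `2g`-form on `X × X` and acting on `H(X)` by
Lange's literal action (6.6) `p(x) = p_{2*}(p ∧ p₁^*x)` (`corrAct`; ANY enumeration `e₁` of the lattice basis, no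
orientation hypothesis):
* **`IsRiemannForm.corrAct_schollProjector_apply`: `p_i(x) = x` for `x ∈ Hⁱ(X)` and `p_i(x) = 0` for `x ∈ Hᵃ(X)`,
  `a ≠ i`** — `p_i` IS the `i`-th Künneth projector as an operator on `H•(X)` ("`cl(p_i)` is the `i`th Künneth
  component of the diagonal", operator form);
* **`IsRiemannForm.sum_corrAct_schollProjector_apply`: `(p₀ + ⋯ + p_{2g})(x) = x`** on every `Hᵃ(X)`
  ("`p₀ + p₁ + ⋯ + p_{2g} = Δ_A`" acting as the identity);
* **`IsRiemannForm.pullG_prodComm_schollProjector`: `σ^*p_i = p_{2g-i}`** in the graded ring (`σ` the exchange of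
  the factors of `X × X`): Künnemann's symmetry `ᵗp_i = p_{2g-i}` of the explicit projectors (Lange Prop. 6.3.10
  `ᵗπ_i = π_{2g-i}` for the divisor polynomials).

## References

* [Milne1999LefschetzClasses] J. S. Milne, *Lefschetz classes on abelian varieties*, Duke Math. J. 96 (1999), §5
  Thm. 5.10 (proof and the sentence following Rem. 5.10's proof, p. 665).
* [Lange2023AbelianVarietiesComplex] H. Lange, *Abelian Varieties over the Complex Numbers* (2023), §6.2.2 (6.6),
  §6.3.4 Prop. 6.3.10, Prop. 6.3.11.
-/

noncomputable section

open scoped Manifold ContDiff Topology Real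
open Set Function Complex Finset Module
open Literature.LinearAlgebra.Alternating
open Literature.LinearAlgebra.Alternating.GForm (of pullG IsHomog)

namespace Literature.Geometry.Kaehler

namespace ComplexTorus

section SchollAction

variable {ι : Type*} [Fintype ι] [DecidableEq ι] {E : Type*} [NormedAddCommGroup E] [NormedSpace ℂ E]
  (Φ : (ι → ℝ) ≃L[ℝ] E) {g : ℕ} {η : E [⋀^Fin 2]→L[ℝ] ℝ}

/-- **THEOREM (Milne 1999, Thm. 5.10 — "`cl(p_i)` is the `i`th Künneth component of the diagonal" — as operators,
at torus level): Scholl's explicit divisor polynomial `p_i` acts on `H•(X)` as the `i`-th Künneth projector: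
`p_i(x) = x` for `x ∈ Hⁱ(X)`, `p_i(x) = 0` for `x ∈ Hᵃ(X)`, `a ≠ i`** (`0 ≤ i ≤ 2g`; the `2g`-form `p_i` read along
`2g = b + a` and acting by Lange's (6.6) `corrAct` along any enumeration `e₁`). Proof: `(p_i)_{2g} = π_i` (Q1166) and
`π_i` acts as `δ_{i,a}` on `Hᵃ(X)` (Q383). [cite: Milne1999LefschetzClasses, §5 Thm. 5.10 (proof)] -/
theorem IsRiemannForm.corrAct_schollProjector_apply (hη : IsRiemannForm Φ η) {d : Fin g → ℕ}
    (hd : IsPolarizationType Φ η d) {i : ℕ} (hi : i ≤ 2 * g) {a b : ℕ} (e₁ : Fin (a + b) ≃ ι)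
    (hba : 2 * g = b + a) (x : E [⋀^Fin a]→L[ℝ] ℂ) :
    corrAct Φ Φ e₁
        ((((-1 : ℂ) ^ i / ∏ k, (d k : ℂ)) •
            ∑ j ∈ Finset.Icc (i - g) (i / 2),
              ((Nat.factorial j * Nat.factorial (g + j - i) * Nat.factorial (i - 2 * j) : ℕ) : ℂ)⁻¹ •
                ((of 2 ((ofRealForm (-η)).compContinuousLinearMap (ContinuousLinearMap.fst ℝ E E)) : GForm (E × E) ℂ) ^ (g + j - i) *
                of 2 ((ofRealForm (-η)).compContinuousLinearMap (ContinuousLinearMap.snd ℝ E E)) ^ j *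
                of 2 (((ofRealForm (-η)).compContinuousLinearMap (ContinuousLinearMap.fst ℝ E E +
                    ContinuousLinearMap.snd ℝ E E)) -
                  ((ofRealForm (-η)).compContinuousLinearMap (ContinuousLinearMap.fst ℝ E E)) -
                  ((ofRealForm (-η)).compContinuousLinearMap (ContinuousLinearMap.snd ℝ E E))) ^ (i - 2 * j)) (2 * g)).domDomCongr (finCongr hba)) x =
      if i = a then x else 0 := by
  have e : Fin (2 * g) ≃ ι := (finCongr (by omega)).trans e₁
  obtain ⟨e₀, he₀⟩ := exists_orientationSign_eq_one Φ e
  have e' : Fin (2 * g + 2 * g) ≃ ι ⊕ ι := finSumFinEquiv.symm.trans (e₀.sumCongr e₀)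
  rw [hη.schollProjector_apply_eq_kunnethComponent_cycleForm_diagonal Φ e₀ he₀ e' hd hi]
  exact corrAct_kunnethComponent_cycleForm_diagonal_cast Φ e₀ he₀ e' e₁ hba x i

/-- **"`p₀ + p₁ + ⋯ + p_{2g} = Δ_A`" acting on cohomology: `Σ_{i ≤ 2g} p_i(x) = x`** for every `x ∈ Hᵃ(X)` (the
diagonal acts as the identity). [cite: Milne1999LefschetzClasses, §5 Thm. 5.10 (proof)] -/
theorem IsRiemannForm.sum_corrAct_schollProjector_apply (hη : IsRiemannForm Φ η) {d : Fin g → ℕ}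
    (hd : IsPolarizationType Φ η d) {a b : ℕ} (e₁ : Fin (a + b) ≃ ι) (hba : 2 * g = b + a)
    (x : E [⋀^Fin a]→L[ℝ] ℂ) :
    ∑ i ∈ Finset.range (2 * g + 1), corrAct Φ Φ e₁
        ((((-1 : ℂ) ^ i / ∏ k, (d k : ℂ)) •
            ∑ j ∈ Finset.Icc (i - g) (i / 2),
              ((Nat.factorial j * Nat.factorial (g + j - i) * Nat.factorial (i - 2 * j) : ℕ) : ℂ)⁻¹ •
                ((of 2 ((ofRealForm (-η)).compContinuousLinearMap (ContinuousLinearMap.fst ℝ E E)) : GForm (E × E) ℂ) ^ (g + j - i) *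
                of 2 ((ofRealForm (-η)).compContinuousLinearMap (ContinuousLinearMap.snd ℝ E E)) ^ j *
                of 2 (((ofRealForm (-η)).compContinuousLinearMap (ContinuousLinearMap.fst ℝ E E +
                    ContinuousLinearMap.snd ℝ E E)) -
                  ((ofRealForm (-η)).compContinuousLinearMap (ContinuousLinearMap.fst ℝ E E)) -
                  ((ofRealForm (-η)).compContinuousLinearMap (ContinuousLinearMap.snd ℝ E E))) ^ (i - 2 * j)) (2 * g)).domDomCongr (finCongr hba)) x = x := by
  rw [Finset.sum_congr rfl fun i hi ↦ hη.corrAct_schollProjector_apply Φ hd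
      (Nat.le_of_lt_succ (Finset.mem_range.1 hi)) e₁ hba x,
    Finset.sum_ite_eq' (Finset.range (2 * g + 1)) a (fun _ ↦ x), if_pos (Finset.mem_range.2 (by omega))]

/-- **Künnemann's symmetry `ᵗp_i = p_{2g-i}` for Scholl's explicit projectors: `σ^*p_i = p_{2g-i}`** in the graded
ring of invariant forms on `X × X` (`σ` the exchange of the factors; `0 ≤ i ≤ 2g`; any enumeration `e` of the
lattice basis) — from `p_i = of (2g) π_i` (Q1166) and `σ^*π_i = π_{2g-i}` (Lange Prop. 6.3.10).
[cite: Milne1999LefschetzClasses, §5 Thm. 5.10 (proof)] [cite: Lange2023AbelianVarietiesComplex, §6.3.4 Prop. 6.3.10] -/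
theorem IsRiemannForm.pullG_prodComm_schollProjector (hη : IsRiemannForm Φ η) {d : Fin g → ℕ}
    (hd : IsPolarizationType Φ η d) (e : Fin (2 * g) ≃ ι) {i : ℕ} (hi : i ≤ 2 * g) :
    pullG (ContinuousLinearEquiv.prodComm ℝ E E : E × E →L[ℝ] E × E)
        (((-1 : ℂ) ^ i / ∏ k, (d k : ℂ)) •
          ∑ j ∈ Finset.Icc (i - g) (i / 2),
            ((Nat.factorial j * Nat.factorial (g + j - i) * Nat.factorial (i - 2 * j) : ℕ) : ℂ)⁻¹ •
              ((of 2 ((ofRealForm (-η)).compContinuousLinearMap (ContinuousLinearMap.fst ℝ E E)) : GForm (E × E) ℂ) ^ (g + j - i) *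
                of 2 ((ofRealForm (-η)).compContinuousLinearMap (ContinuousLinearMap.snd ℝ E E)) ^ j *
                of 2 (((ofRealForm (-η)).compContinuousLinearMap (ContinuousLinearMap.fst ℝ E E +
                    ContinuousLinearMap.snd ℝ E E)) -
                  ((ofRealForm (-η)).compContinuousLinearMap (ContinuousLinearMap.fst ℝ E E)) -
                  ((ofRealForm (-η)).compContinuousLinearMap (ContinuousLinearMap.snd ℝ E E))) ^ (i - 2 * j))) =
      ((-1 : ℂ) ^ (2 * g - i) / ∏ k, (d k : ℂ)) •
          ∑ j ∈ Finset.Icc ((2 * g - i) - g) ((2 * g - i) / 2),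
            ((Nat.factorial j * Nat.factorial (g + j - (2 * g - i)) * Nat.factorial ((2 * g - i) - 2 * j) : ℕ) : ℂ)⁻¹ •
              ((of 2 ((ofRealForm (-η)).compContinuousLinearMap (ContinuousLinearMap.fst ℝ E E)) : GForm (E × E) ℂ) ^ (g + j - (2 * g - i)) *
                of 2 ((ofRealForm (-η)).compContinuousLinearMap (ContinuousLinearMap.snd ℝ E E)) ^ j *
                of 2 (((ofRealForm (-η)).compContinuousLinearMap (ContinuousLinearMap.fst ℝ E E +
                    ContinuousLinearMap.snd ℝ E E)) -
                  ((ofRealForm (-η)).compContinuousLinearMap (ContinuousLinearMap.fst ℝ E E)) -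
                  ((ofRealForm (-η)).compContinuousLinearMap (ContinuousLinearMap.snd ℝ E E))) ^ ((2 * g - i) - 2 * j)) := by
  obtain ⟨e₀, he₀⟩ := exists_orientationSign_eq_one Φ e
  have e' : Fin (2 * g + 2 * g) ≃ ι ⊕ ι := finSumFinEquiv.symm.trans (e₀.sumCongr e₀)
  rw [hη.schollProjector_eq_of_kunnethComponent_cycleForm_diagonal Φ e₀ he₀ e' hd hi,
    hη.schollProjector_eq_of_kunnethComponent_cycleForm_diagonal Φ e₀ he₀ e' hd (by omega : 2 * g - i ≤ 2 * g),
    GForm.pullG_of, kunnethComponent_cycleForm_diagonal_compContinuousLinearMap_prodComm Φ e₀ he₀ e' hi]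

end SchollAction

end ComplexTorus

end Literature.Geometry.Kaehler
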